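import Literature.Probability.Percolation.StaticRenormalizationBoxes
import Literature.Probability.Percolation.CriticalContinuity
import HarnessLib

/-!
# Aizenman 1997, Theorem 2: more than one incipient spanning cluster in thin slab-boxes at `p_c` (statement, `d = 3`)

Topic `Literature/Probability/Percolation`.  M. Aizenman, *On the number of incipient spanning clusters*, Nucl. Phys.
B 485 (1997) 551–582 (arXiv:cond-mat/9609240), §2, Theorem 2: "For any dimension `d > 1` there is a function `g_d(t)`,
strictly positive for `0 ≤ t < t₀`, with which for every finite size `L`:
`D_L(t, p_c) ≡ Prob(there is more than one spanning cluster in S_{L,t} = [0, tL] × [0, L]^{d-1}) ≥ g_d(t)`."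
(Remark 1 there: the bound holds only at `p = p_c`; for `p ≠ p_c`, `D_L → 0`.)  The proof for `d ≥ 3` (p. 3 of the
arXiv version) is a same-density renormalisation with cells `[0,tL] × [0,L/3]²`, "regular" = spanned ∧ the `3 × 3` block
has exactly one spanning cluster, and a Peierls estimate on the planar cell lattice ("`Prob(cell irregular) · 20 < 1` ⇒
percolation"), giving `(1 - R_{L/3,3t}) + D_{L,t} ≥ 0.05` for every `p ≤ p_c`.

This file only STATES the `d = 3` bond-percolation case, in the uniform-threshold form (one constant `c` for all aspect
ratios `t = n/M ≤ 1/K`), with "more than one spanning cluster" written via the toolbox event `inConn` ("two open lattice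
paths inside the box joining its two thin faces, not joined by an open path inside the box").  It is PROVED in the tree:
`Summit.CriticalPhenomena.PercolationContinuityZ3.Theorems.Rsw3.aizenman_twoSpanningClusters_criticalProbI`
(`Summits/…/Theorems/PercNearOneGluingNoHeavyRsw3SlabSpanningClusters.lean`, RSW3 lane), which supplies
`c = (KestenZhang.critTwoArmsDelta 2)^{49}/2`; the discharge `…_holds` is filed under `Summits/` (it imports that lane file).

## References

* M. Aizenman, *On the number of incipient spanning clusters*, Nucl. Phys. B 485 (1997) 551–582, §2 Thm. 2
  [Aizenman1997].
-/

noncomputable section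

namespace Literature.Probability.Percolation

open _root_.MeasureTheory LatticeModels

/-- **Aizenman 1997, Theorem 2 (case `d = 3`, bond percolation on `ℤ³`; uniform-threshold form).**  There are `c > 0`
and `K ∈ ℕ` such that for every thin side `n ≥ 1` and every transverse side `M ≥ K n`, at `p = p_c(ℤ³)` the slab-box
`{0..n} × {0..M}² = Finset.Icc 0 (n, M, M)` contains two open lattice paths inside the box, each joining the face
`{x₀ = 0}` to the face `{x₀ = n}`, that are NOT joined by an open path inside the box (i.e. the box is traversed by
more than one spanning cluster, free boundary conditions), with probability at least `c`:
`D_{M}(n/M, p_c) ≥ c` for all `M ≥ K n`.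
-- TODO(general form): Aizenman proves this for every `d > 1` with a positive function `g_d(t)` on `[0, t₀)`.
[cite: Aizenman1997, §2 Thm. 2] -/
def Aizenman1997TwoSpanningClustersZ3 : Prop :=
  ∃ c : ℝ, 0 < c ∧ ∃ K : ℕ, ∀ n : ℕ, 1 ≤ n → ∀ M : ℕ, K * n ≤ M →
    c ≤ (bondPercolation (zdGraph 3) (criticalProbI 3)).real
      {ω : BondConfig (Site 3) | ∃ x ∈ Finset.Icc (0 : Site 3) ![(n : ℤ), M, M], ∃ x' ∈ Finset.Icc (0 : Site 3) ![(n : ℤ), M, M],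
        ∃ y ∈ Finset.Icc (0 : Site 3) ![(n : ℤ), M, M], ∃ y' ∈ Finset.Icc (0 : Site 3) ![(n : ℤ), M, M],
        x 0 = 0 ∧ x' 0 = 0 ∧ y 0 = (n : ℤ) ∧ y' 0 = (n : ℤ) ∧
        ω ∈ inConn ↑(Finset.Icc (0 : Site 3) ![(n : ℤ), M, M]) x y ∧
        ω ∈ inConn ↑(Finset.Icc (0 : Site 3) ![(n : ℤ), M, M]) x' y' ∧
        ω ∉ inConn ↑(Finset.Icc (0 : Site 3) ![(n : ℤ), M, M]) x x'}

end Literature.Probability.Percolation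

end
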